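import Summits.QuantumFields.YangMills.Theorems.FluctuationComparisonRegPrIntLOrganTangentFibreMeanSquareKnit
import HarnessLib

/-!
# Crux `FluctuationComparisonRegPrIntL` (stmt-QuantumFields-20520, rung R3), PATH-B organ, v18 (H-currency) — (R2b) THE RESPONSE EDITION OF BRICK 2b:
# with NORMALISED corner weights the centring constants drop and the knit reads `ΔΔ m = PULL-BACK + (E₁₁ − E₁₀)[G₁] + (E₁₁ − E₀₁)[G₂] + ΔΔ_{ab} E_{ab}[F₀₀]`

Cell `ym3-torus` (YM ladder rung R3 = continuum `SU(2)` Yang–Mills on the three-torus — a RUNG: NOT d = 4, NOT infinite volume, NOT a mass gap, NOT Clay).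
Width seat `ym-ust-20520-w5` (gen 23), `--supports stmt-QuantumFields-20520 --as helper`, count-neutral, no registry ∕ binder ∕ `Lines/` edit, DEFINITION-FREE,
default heartbeats.  Over BRICK 2b ✓p807533 `…OrganTangentFibreMeanSquareKnit` (LEAD w3 g25).

WHAT THIS IS.  On ONE fibre `(Ω, P)` with four corner integrands `F_ab` (bounded, a.e.-strongly measurable) and four NORMALISED weights `ŵ_ab` (integrable,
`∫ ŵ_ab ∂P = 1`), write `E_ab[f] := ∫ f·ŵ_ab ∂P`, `m_ab := E_ab[F_ab]`, `G₁ := F₁₀ − F₀₀`, `G₂ := F₀₁ − F₀₀`.  ★`fibreMean_secondDiff_eq_response`: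
`m₁₁ − m₁₀ − m₀₁ + m₀₀ = E₁₁[F₁₁ − F₁₀ − F₀₁ + F₀₀] + (E₁₁[G₁] − E₁₀[G₁]) + (E₁₁[G₂] − E₀₁[G₂]) + (E₁₁[F₀₀] − E₁₀[F₀₀] − E₀₁[F₀₀] + E₀₀[F₀₀])`
— BRICK 2b's exact identity ✓`fibreMean_secondDiff_eq` at `c₁ = c₂ = c₀ = 0`, re-bracketed as LAW RESPONSES: channel 1∕2 = the FIRST-ORDER response of the corner law
along one coarse edge tested on a first difference `Gᵢ`, channel 0 = the SECOND-ORDER response of the corner laws tested on `F₀₀` (ideator g28 №3 TN-COV-12: «the docking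
surface is 2b's exact identity; no ratios, no `√`»).  ★`abs_fibreMean_secondDiff_le_response`: `|ΔΔ m| ≤ A + L₁ + L₂ + L₀` from the pull-back letter `|E₁₁[ΔΔF]| ≤ A`
(BRICK 2a) and three RESPONSE LETTERS taken as hypotheses in the shape of FibreLawH v0.2's (L1)∕(L2) clauses (`|E_{V′}[ĝ] − E_V[ĝ]| ≤ L`), and
`abs_pullback_le_of_sup` (`|E₁₁[ΔΔF]| ≤ A` from a sup bound and `ŵ₁₁ ≥ 0`).

HONEST FRAMING: `integral_sub` bookkeeping over HYPOTHESIS data; the letters `A L₁ L₂ L₀` are NOT estimated here ((L1)∕(L2) of FibreLawH, BRICK 2a); nothing of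
Bałaban's analysis is asserted or proved; LINᵘ-H ∕ JVARᵘ-H ∕ O1ᵘ-H v2 ∕ S1aᴴ ∕ 26243 ∕ S2α′ ∕ S2β OPEN; crux 20520 `FluctuationComparisonRegPrIntL` ∕ `YM3TorusSU2` NOT proved; no
summit ∕ sub-problem statement is proved; registry untouched; rung R3 = SU(2) YM₃ on T³ at fixed lattice data — NOT d = 4, NOT infinite volume, NOT a mass gap, NOT Clay;
the Yang–Mills mass gap is NOT proved.  [folklore].
-/

set_option autoImplicit false

noncomputable section

namespace Summit.QuantumFields.YangMills.Theorems.OrganTangentFibreMeanSquareResponse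

open MeasureTheory
open Summit.QuantumFields.YangMills.Theorems.OrganTangentFibreMeanSquareKnit (integrable_bdd_mul fibreMean_secondDiff_eq)

variable {Ω : Type*} [MeasurableSpace Ω]

/-- ★ **THE RESPONSE EDITION OF THE FIBRE-MEAN SQUARE KNIT** (see the module docstring). [folklore] -/
theorem fibreMean_secondDiff_eq_response (P : Measure Ω)
    (F₀₀ F₁₀ F₀₁ F₁₁ w₀₀ w₁₀ w₀₁ w₁₁ : Ω → ℝ) (M : ℝ)
    (hF₀₀ : AEStronglyMeasurable F₀₀ P) (hF₁₀ : AEStronglyMeasurable F₁₀ P)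
    (hF₀₁ : AEStronglyMeasurable F₀₁ P) (hF₁₁ : AEStronglyMeasurable F₁₁ P)
    (hb₀₀ : ∀ ξ, |F₀₀ ξ| ≤ M) (hb₁₀ : ∀ ξ, |F₁₀ ξ| ≤ M) (hb₀₁ : ∀ ξ, |F₀₁ ξ| ≤ M) (hb₁₁ : ∀ ξ, |F₁₁ ξ| ≤ M)
    (hw₀₀ : Integrable w₀₀ P) (hw₁₀ : Integrable w₁₀ P) (hw₀₁ : Integrable w₀₁ P) (hw₁₁ : Integrable w₁₁ P)
    (hn₀₀ : ∫ ξ, w₀₀ ξ ∂P = 1) (hn₁₀ : ∫ ξ, w₁₀ ξ ∂P = 1) (hn₀₁ : ∫ ξ, w₀₁ ξ ∂P = 1) (hn₁₁ : ∫ ξ, w₁₁ ξ ∂P = 1) :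
    (∫ ξ, F₁₁ ξ * w₁₁ ξ ∂P) - (∫ ξ, F₁₀ ξ * w₁₀ ξ ∂P) - (∫ ξ, F₀₁ ξ * w₀₁ ξ ∂P) + (∫ ξ, F₀₀ ξ * w₀₀ ξ ∂P)
      = (∫ ξ, (F₁₁ ξ - F₁₀ ξ - F₀₁ ξ + F₀₀ ξ) * w₁₁ ξ ∂P)
        + ((∫ ξ, (F₁₀ ξ - F₀₀ ξ) * w₁₁ ξ ∂P) - (∫ ξ, (F₁₀ ξ - F₀₀ ξ) * w₁₀ ξ ∂P))
        + ((∫ ξ, (F₀₁ ξ - F₀₀ ξ) * w₁₁ ξ ∂P) - (∫ ξ, (F₀₁ ξ - F₀₀ ξ) * w₀₁ ξ ∂P))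
        + ((∫ ξ, F₀₀ ξ * w₁₁ ξ ∂P) - (∫ ξ, F₀₀ ξ * w₁₀ ξ ∂P) - (∫ ξ, F₀₀ ξ * w₀₁ ξ ∂P) + (∫ ξ, F₀₀ ξ * w₀₀ ξ ∂P)) := by
  rw [fibreMean_secondDiff_eq P F₀₀ F₁₀ F₀₁ F₁₁ w₀₀ w₁₀ w₀₁ w₁₁ M 0 0 0 hF₀₀ hF₁₀ hF₀₁ hF₁₁ hb₀₀ hb₁₀ hb₀₁ hb₁₁
    hw₀₀ hw₁₀ hw₀₁ hw₁₁ hn₀₀ hn₁₀ hn₀₁ hn₁₁]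
  simp only [sub_zero]
  -- bounds for the differences
  have hG₁ : ∀ ξ, |F₁₀ ξ - F₀₀ ξ| ≤ 2 * M := fun ξ => by
    have := abs_sub (F₁₀ ξ) (F₀₀ ξ); linarith [hb₁₀ ξ, hb₀₀ ξ]
  have hG₂ : ∀ ξ, |F₀₁ ξ - F₀₀ ξ| ≤ 2 * M := fun ξ => by
    have := abs_sub (F₀₁ ξ) (F₀₀ ξ); linarith [hb₀₁ ξ, hb₀₀ ξ]
  have hG₁m : AEStronglyMeasurable (fun ξ => F₁₀ ξ - F₀₀ ξ) P := hF₁₀.sub hF₀₀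
  have hG₂m : AEStronglyMeasurable (fun ξ => F₀₁ ξ - F₀₀ ξ) P := hF₀₁.sub hF₀₀
  -- each channel: ∫ G·(w − w') = ∫ G·w − ∫ G·w'
  have e1 : ∫ ξ, (F₁₀ ξ - F₀₀ ξ) * (w₁₁ ξ - w₁₀ ξ) ∂P
      = (∫ ξ, (F₁₀ ξ - F₀₀ ξ) * w₁₁ ξ ∂P) - (∫ ξ, (F₁₀ ξ - F₀₀ ξ) * w₁₀ ξ ∂P) := by
    rw [← integral_sub (integrable_bdd_mul hG₁m hG₁ hw₁₁) (integrable_bdd_mul hG₁m hG₁ hw₁₀)]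
    refine integral_congr_ae (Filter.Eventually.of_forall fun ξ => ?_)
    simp only
    ring
  have e2 : ∫ ξ, (F₀₁ ξ - F₀₀ ξ) * (w₁₁ ξ - w₀₁ ξ) ∂P
      = (∫ ξ, (F₀₁ ξ - F₀₀ ξ) * w₁₁ ξ ∂P) - (∫ ξ, (F₀₁ ξ - F₀₀ ξ) * w₀₁ ξ ∂P) := by
    rw [← integral_sub (integrable_bdd_mul hG₂m hG₂ hw₁₁) (integrable_bdd_mul hG₂m hG₂ hw₀₁)]
    refine integral_congr_ae (Filter.Eventually.of_forall fun ξ => ?_)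
    simp only
    ring
  have i11 : Integrable (fun ξ => F₀₀ ξ * w₁₁ ξ) P := integrable_bdd_mul hF₀₀ hb₀₀ hw₁₁
  have i10 : Integrable (fun ξ => F₀₀ ξ * w₁₀ ξ) P := integrable_bdd_mul hF₀₀ hb₀₀ hw₁₀
  have i01 : Integrable (fun ξ => F₀₀ ξ * w₀₁ ξ) P := integrable_bdd_mul hF₀₀ hb₀₀ hw₀₁
  have i00 : Integrable (fun ξ => F₀₀ ξ * w₀₀ ξ) P := integrable_bdd_mul hF₀₀ hb₀₀ hw₀₀
  have iA : Integrable (fun ξ => F₀₀ ξ * w₁₁ ξ - F₀₀ ξ * w₁₀ ξ) P := i11.sub i10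
  have iB : Integrable (fun ξ => (F₀₀ ξ * w₁₁ ξ - F₀₀ ξ * w₁₀ ξ) - F₀₀ ξ * w₀₁ ξ) P := iA.sub i01
  have e3 : ∫ ξ, F₀₀ ξ * (w₁₁ ξ - w₁₀ ξ - w₀₁ ξ + w₀₀ ξ) ∂P
      = (∫ ξ, F₀₀ ξ * w₁₁ ξ ∂P) - (∫ ξ, F₀₀ ξ * w₁₀ ξ ∂P) - (∫ ξ, F₀₀ ξ * w₀₁ ξ ∂P) + (∫ ξ, F₀₀ ξ * w₀₀ ξ ∂P) := by
    calc ∫ ξ, F₀₀ ξ * (w₁₁ ξ - w₁₀ ξ - w₀₁ ξ + w₀₀ ξ) ∂P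
        = ∫ ξ, ((F₀₀ ξ * w₁₁ ξ - F₀₀ ξ * w₁₀ ξ) - F₀₀ ξ * w₀₁ ξ) + F₀₀ ξ * w₀₀ ξ ∂P := by
          refine integral_congr_ae (Filter.Eventually.of_forall fun ξ => ?_)
          simp only
          ring
      _ = (∫ ξ, (F₀₀ ξ * w₁₁ ξ - F₀₀ ξ * w₁₀ ξ) - F₀₀ ξ * w₀₁ ξ ∂P) + ∫ ξ, F₀₀ ξ * w₀₀ ξ ∂P := integral_add iB i00
      _ = ((∫ ξ, F₀₀ ξ * w₁₁ ξ - F₀₀ ξ * w₁₀ ξ ∂P) - ∫ ξ, F₀₀ ξ * w₀₁ ξ ∂P) + ∫ ξ, F₀₀ ξ * w₀₀ ξ ∂P := by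
          rw [integral_sub iA i01]
      _ = (∫ ξ, F₀₀ ξ * w₁₁ ξ ∂P) - (∫ ξ, F₀₀ ξ * w₁₀ ξ ∂P) - (∫ ξ, F₀₀ ξ * w₀₁ ξ ∂P) + (∫ ξ, F₀₀ ξ * w₀₀ ξ ∂P) := by
          rw [integral_sub i11 i10]
  rw [e1, e2, e3]

/-- `|E₁₁[ΔΔF]| ≤ A` from a sup bound `|ΔΔF| ≤ A` and a non-negative normalised weight (the PULL-BACK channel's reading). [folklore] -/
theorem abs_pullback_le_of_sup (P : Measure Ω) (D w : Ω → ℝ) (A : ℝ) (hw : Integrable w P) (hn : ∫ ξ, w ξ ∂P = 1)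
    (hpos : ∀ ξ, 0 ≤ w ξ) (hA : ∀ ξ, |D ξ| ≤ A) : |∫ ξ, D ξ * w ξ ∂P| ≤ A := by
  have hle : ∀ ξ, |D ξ * w ξ| ≤ A * w ξ := fun ξ => by
    rw [abs_mul, abs_of_nonneg (hpos ξ)]
    exact mul_le_mul_of_nonneg_right (hA ξ) (hpos ξ)
  calc |∫ ξ, D ξ * w ξ ∂P| ≤ ∫ ξ, |D ξ * w ξ| ∂P := by
        simpa only [Real.norm_eq_abs] using norm_integral_le_integral_norm (fun ξ => D ξ * w ξ)
    _ ≤ ∫ ξ, A * w ξ ∂P :=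
        integral_mono_of_nonneg (Filter.Eventually.of_forall fun ξ => abs_nonneg _) (hw.const_mul A) (Filter.Eventually.of_forall hle)
    _ = A := by rw [integral_const_mul, hn, mul_one]

/-- ★ **THE RESPONSE READING**: `|ΔΔ m| ≤ A + L₁ + L₂ + L₀` from the pull-back letter `|E₁₁[ΔΔF]| ≤ A` and three RESPONSE letters (hypotheses, FibreLawH (L1)∕(L2)
shape): `|E₁₁[G₁] − E₁₀[G₁]| ≤ L₁`, `|E₁₁[G₂] − E₀₁[G₂]| ≤ L₂`, `|ΔΔ_{ab} E_{ab}[F₀₀]| ≤ L₀`. [folklore] -/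
theorem abs_fibreMean_secondDiff_le_response (P : Measure Ω)
    (F₀₀ F₁₀ F₀₁ F₁₁ w₀₀ w₁₀ w₀₁ w₁₁ : Ω → ℝ) (M A L₁ L₂ L₀ : ℝ)
    (hF₀₀ : AEStronglyMeasurable F₀₀ P) (hF₁₀ : AEStronglyMeasurable F₁₀ P)
    (hF₀₁ : AEStronglyMeasurable F₀₁ P) (hF₁₁ : AEStronglyMeasurable F₁₁ P)
    (hb₀₀ : ∀ ξ, |F₀₀ ξ| ≤ M) (hb₁₀ : ∀ ξ, |F₁₀ ξ| ≤ M) (hb₀₁ : ∀ ξ, |F₀₁ ξ| ≤ M) (hb₁₁ : ∀ ξ, |F₁₁ ξ| ≤ M)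
    (hw₀₀ : Integrable w₀₀ P) (hw₁₀ : Integrable w₁₀ P) (hw₀₁ : Integrable w₀₁ P) (hw₁₁ : Integrable w₁₁ P)
    (hn₀₀ : ∫ ξ, w₀₀ ξ ∂P = 1) (hn₁₀ : ∫ ξ, w₁₀ ξ ∂P = 1) (hn₀₁ : ∫ ξ, w₀₁ ξ ∂P = 1) (hn₁₁ : ∫ ξ, w₁₁ ξ ∂P = 1)
    (hA : |∫ ξ, (F₁₁ ξ - F₁₀ ξ - F₀₁ ξ + F₀₀ ξ) * w₁₁ ξ ∂P| ≤ A)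
    (hL₁ : |(∫ ξ, (F₁₀ ξ - F₀₀ ξ) * w₁₁ ξ ∂P) - (∫ ξ, (F₁₀ ξ - F₀₀ ξ) * w₁₀ ξ ∂P)| ≤ L₁)
    (hL₂ : |(∫ ξ, (F₀₁ ξ - F₀₀ ξ) * w₁₁ ξ ∂P) - (∫ ξ, (F₀₁ ξ - F₀₀ ξ) * w₀₁ ξ ∂P)| ≤ L₂)
    (hL₀ : |(∫ ξ, F₀₀ ξ * w₁₁ ξ ∂P) - (∫ ξ, F₀₀ ξ * w₁₀ ξ ∂P) - (∫ ξ, F₀₀ ξ * w₀₁ ξ ∂P) + (∫ ξ, F₀₀ ξ * w₀₀ ξ ∂P)| ≤ L₀) :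
    |(∫ ξ, F₁₁ ξ * w₁₁ ξ ∂P) - (∫ ξ, F₁₀ ξ * w₁₀ ξ ∂P) - (∫ ξ, F₀₁ ξ * w₀₁ ξ ∂P) + (∫ ξ, F₀₀ ξ * w₀₀ ξ ∂P)|
      ≤ A + L₁ + L₂ + L₀ := by
  rw [fibreMean_secondDiff_eq_response P F₀₀ F₁₀ F₀₁ F₁₁ w₀₀ w₁₀ w₀₁ w₁₁ M hF₀₀ hF₁₀ hF₀₁ hF₁₁ hb₀₀ hb₁₀ hb₀₁ hb₁₁
    hw₀₀ hw₁₀ hw₀₁ hw₁₁ hn₀₀ hn₁₀ hn₀₁ hn₁₁]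
  refine le_trans (abs_add_le _ _) (add_le_add (le_trans (abs_add_le _ _) (add_le_add (le_trans (abs_add_le _ _) (add_le_add hA hL₁)) hL₂)) hL₀)

end Summit.QuantumFields.YangMills.Theorems.OrganTangentFibreMeanSquareResponse

end
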